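import Summits.QuantumFields.YangMills.Theses.ColdStartUniversality
import HarnessLib

/-!
# Route `ColdStartUniversality`, crux K_A1|Γ `NeutralColdStartMixing` (stmt-QuantumFields-27363), LINE 7: BOTH PROPOSED
# RE-TYPINGS OF STUB 2 `ValleyCesaroMixing` ARE WEAKENINGS OF THE ITEM AS TYPED (a fortiori)

Helper file (seat `ym-line-csu-p1`, g14; `--supports stmt-QuantumFields-27363`).  Companion of
`…NeutralColdStartMixingEvenValleyMixing` (p720334) and `…NeutralColdStartMixingAbsValley` (p720869), which show that the
crux still follows from stub 1 and either re-typed stub 2.  Here: item 27404 AS TYPED implies each re-typing, so a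
re-typing loses no provability and removes the charged sector (`…ValleyChargedSector`, p720043) from what stub 2 asks.

* `valleyCesaroMixingEven_of_valleyCesaroMixing` — 27404 ⟹ 27404 restricted to twist-invariant test functions (drop
  the extra hypothesis);
* `valleyCesaroMixingAbs_of_valleyCesaroMixing` — 27404 ⟹ 27404 with `θ_K ↦ |θ_K|` (a `σ(|θ_K|)`-measurable test function
  is `σ(θ_K)`-measurable: `σ(|θ_K|) ≤ σ(θ_K)`).

THEOREMS ONLY; custody information; no crux, rung or summit statement is proved here and the Yang–Mills mass gap is
NOT proved.
-/

set_option autoImplicit false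

noncomputable section

namespace Summit.QuantumFields.YangMills.Theorems.ColdStartUniversality

open MeasureTheory
open Summit.QuantumFields.YangMills.Theses.ColdStartUniversality

/-- **27404 ⟹ 27404|even** (the extra twist-invariance hypothesis on the test function is simply not used). [folklore] -/
theorem valleyCesaroMixingEven_of_valleyCesaroMixing (h : ValleyCesaroMixing) :
    (∃ γ₁ : ℝ, 0 < γ₁ ∧ ∀ (F : Literature.MathematicalPhysics.QuantumFieldTheory.Balaban1983to89.T3ContinuumYM3Torus.T3Family) (γ : ℝ), 0 < γ → γ ≤ γ₁ → ∀ (δ : ℝ), 0 < δ → ∃ T₀ : ℝ, 0 < T₀ ∧ ∃ K₀ : ℕ, ∀ K : ℕ, K₀ ≤ K → ∀ (h : Literature.MathematicalPhysics.QuantumFieldTheory.Balaban1983to89.GaugeField (F.P K) 0 (Matrix.specialUnitaryGroup (Fin 2) ℂ) → ℝ), @MeasureTheory.StronglyMeasurable _ _ _ (MeasurableSpace.comap (fun (V : Literature.MathematicalPhysics.QuantumFieldTheory.Balaban1983to89.GaugeField (F.P K) 0 (Matrix.specialUnitaryGroup (Fin 2) ℂ)) (μ : Fin 3) => (Fintype.card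 F.USite : ℝ)⁻¹ * ∑ x : F.USite, F.avgObs (Literature.MathematicalPhysics.QuantumFieldTheory.Balaban1983to89.ExpMeanLog.expMeanLogSU : Literature.MathematicalPhysics.QuantumFieldTheory.Balaban1983to89.LoopAverage (Matrix.specialUnitaryGroup (Fin 2) ℂ)) K (Literature.MathematicalPhysics.QuantumFieldTheory.Balaban1983to89.T3ContinuumYM3Torus.ULoop3.polyakov μ x) V) MeasurableSpace.pi) h → (∀ᵐ V ∂(Literature.MathematicalPhysics.QuantumFieldTheory.Balaban1983to89.T4GenFunBounds.gibbsMeasure (G := Matrix.specialUnitaryGroup (Fin 2) ℂ) (F.P K) ((F.scheme (Literature.MathematicalPhysics.QuantumFieldTheory.Balaban1983to89.ExpMeanLog.expMeanLogSU : Literature.MathematicalPhysics.QuantumFieldTheory.Balaban1983to89.LoopAverage (Matrix.specialUnitaryGroup (Fin 2) ℂ)) γ).β K)), |h V| ≤ 1) → (∀ μ' : Fin 3, ∃ s : ZMod ((F.P K).sitesPerDir 0), ∀ᵐ V ∂(Literature.MathematicalPhysics.QuantumFieldTheory.Balaban1983to89.T4GenFunBounds.gibbsMeasure (G := Matrix.specialUnitaryGroup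 (Fin 2) ℂ) (F.P K) ((F.scheme (Literature.MathematicalPhysics.QuantumFieldTheory.Balaban1983to89.ExpMeanLog.expMeanLogSU : Literature.MathematicalPhysics.QuantumFieldTheory.Balaban1983to89.LoopAverage (Matrix.specialUnitaryGroup (Fin 2) ℂ)) γ).β K)), h (Literature.MathematicalPhysics.QuantumFieldTheory.Balaban1983to89.GaugeField.ctwist Literature.MathematicalPhysics.QuantumFieldTheory.Balaban1983to89.T3ContinuumYM3Torus.negOne₂ μ' s V) = h V) → ∀ (Ω : Type) (mΩ : MeasurableSpace Ω) (P : MeasureTheory.Measure Ω) (hP : MeasureTheory.IsProbabilityMeasure P) (W : NNReal → Ω → (Literature.MathematicalPhysics.QuantumFieldTheory.Edge 3 ((F.P K).sitesPerDir 0) × Literature.MathematicalPhysics.QuantumFieldTheory.NoiseIdx 2 → ℝ)) (hW : Literature.MathematicalPhysics.QuantumFieldTheory.IsFlatBrownian W P) (U : NNReal → Ω → Literature.MathematicalPhysics.QuantumFieldTheory.GaugeConfig 3 ((F.P K).sitesPerDir 0) (Matrix.specialUnitaryGroup (Fin 2) ℂ)), (∀ ω, U 0 ω = fun _ => 1) →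 (Literature.MathematicalPhysics.QuantumFieldTheory.latticeLangevinDynamics (⟨2, Literature.MathematicalPhysics.QuantumLattice.fundamentalRep (Fin 2), Literature.MathematicalPhysics.QuantumLattice.continuous_fundamentalRep _, Literature.MathematicalPhysics.QuantumLattice.fundamentalRep_injective _, Literature.MathematicalPhysics.QuantumLattice.fundamentalRep_mem_unitaryGroup⟩ : Literature.MathematicalPhysics.QuantumFieldTheory.LatticeRep (Matrix.specialUnitaryGroup (Fin 2) ℂ)) ((γ * (F.P K).eps)⁻¹ / 2)).IsSolution (Literature.MathematicalPhysics.QuantumLattice.fundamentalRep (Fin 2)) hW.natFiltration P W U → ∀ (T : ℝ), T₀ ≤ T → |∫ V, h V ∂(Literature.MathematicalPhysics.QuantumFieldTheory.Balaban1983to89.T4GenFunBounds.gibbsMeasure (G := Matrix.specialUnitaryGroup (Fin 2) ℂ) (F.P K) ((F.scheme (Literature.MathematicalPhysics.QuantumFieldTheory.Balaban1983to89.ExpMeanLog.expMeanLogSU : Literature.MathematicalPhysics.QuantumFieldTheory.Balaban1983to89.LoopAverage (Matrix.specialUnitaryGroup (Fin 2) ℂ)) γ).β K)) - T⁻¹ *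 intervalIntegral (fun s : ℝ => MeasureTheory.integral P (fun ω => h (fun b : Literature.MathematicalPhysics.QuantumFieldTheory.Balaban1983to89.PBond (F.P K) 0 => U (s / (F.P K).eps).toNNReal ω (b.src, b.dir)))) 0 T MeasureTheory.volume| ≤ δ) := by
  obtain ⟨γ₁, hγ₁, hmain⟩ := h
  refine ⟨γ₁, hγ₁, fun F γ hγ hγle δ hδ => ?_⟩
  obtain ⟨T₀, hT₀, K₀, hK⟩ := hmain F γ hγ hγle δ hδ
  exact ⟨T₀, hT₀, K₀, fun K hKK h' hSM hbd _ => hK K hKK h' hSM hbd⟩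

/-- **27404 ⟹ 27404[θ ↦ |θ|]**: a test function measurable for the valley-modulo-centre σ-algebra `σ(|θ_K|)` is measurable
for the valley σ-algebra `σ(θ_K)` (`|θ_K| = abs ∘ θ_K` coordinatewise). [folklore] -/
theorem valleyCesaroMixingAbs_of_valleyCesaroMixing (h : ValleyCesaroMixing) :
    (∃ γ₁ : ℝ, 0 < γ₁ ∧ ∀ (F : Literature.MathematicalPhysics.QuantumFieldTheory.Balaban1983to89.T3ContinuumYM3Torus.T3Family) (γ : ℝ), 0 < γ → γ ≤ γ₁ → ∀ (δ : ℝ), 0 < δ → ∃ T₀ : ℝ, 0 < T₀ ∧ ∃ K₀ : ℕ, ∀ K : ℕ, K₀ ≤ K → ∀ (h : Literature.MathematicalPhysics.QuantumFieldTheory.Balaban1983to89.GaugeField (F.P K) 0 (Matrix.specialUnitaryGroup (Fin 2) ℂ) → ℝ), @MeasureTheory.StronglyMeasurable _ _ _ (MeasurableSpace.comap (fun (V : Literature.MathematicalPhysics.QuantumFieldTheory.Balaban1983to89.GaugeField (F.P K) 0 (Matrix.specialUnitaryGroup (Fin 2) ℂ)) (μ : Fin 3) => |(Fintype.card F.USite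 : ℝ)⁻¹ * ∑ x : F.USite, F.avgObs (Literature.MathematicalPhysics.QuantumFieldTheory.Balaban1983to89.ExpMeanLog.expMeanLogSU : Literature.MathematicalPhysics.QuantumFieldTheory.Balaban1983to89.LoopAverage (Matrix.specialUnitaryGroup (Fin 2) ℂ)) K (Literature.MathematicalPhysics.QuantumFieldTheory.Balaban1983to89.T3ContinuumYM3Torus.ULoop3.polyakov μ x) V|) MeasurableSpace.pi) h → (∀ᵐ V ∂(Literature.MathematicalPhysics.QuantumFieldTheory.Balaban1983to89.T4GenFunBounds.gibbsMeasure (G := Matrix.specialUnitaryGroup (Fin 2) ℂ) (F.P K) ((F.scheme (Literature.MathematicalPhysics.QuantumFieldTheory.Balaban1983to89.ExpMeanLog.expMeanLogSU : Literature.MathematicalPhysics.QuantumFieldTheory.Balaban1983to89.LoopAverage (Matrix.specialUnitaryGroup (Fin 2) ℂ)) γ).β K)), |h V| ≤ 1) → ∀ (Ω : Type) (mΩ : MeasurableSpace Ω) (P : MeasureTheory.Measure Ω) (hP : MeasureTheory.IsProbabilityMeasure P) (W : NNReal → Ω → (Literature.MathematicalPhysics.QuantumFieldTheory.Edge 3 ((F.P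 K).sitesPerDir 0) × Literature.MathematicalPhysics.QuantumFieldTheory.NoiseIdx 2 → ℝ)) (hW : Literature.MathematicalPhysics.QuantumFieldTheory.IsFlatBrownian W P) (U : NNReal → Ω → Literature.MathematicalPhysics.QuantumFieldTheory.GaugeConfig 3 ((F.P K).sitesPerDir 0) (Matrix.specialUnitaryGroup (Fin 2) ℂ)), (∀ ω, U 0 ω = fun _ => 1) → (Literature.MathematicalPhysics.QuantumFieldTheory.latticeLangevinDynamics (⟨2, Literature.MathematicalPhysics.QuantumLattice.fundamentalRep (Fin 2), Literature.MathematicalPhysics.QuantumLattice.continuous_fundamentalRep _, Literature.MathematicalPhysics.QuantumLattice.fundamentalRep_injective _, Literature.MathematicalPhysics.QuantumLattice.fundamentalRep_mem_unitaryGroup⟩ : Literature.MathematicalPhysics.QuantumFieldTheory.LatticeRep (Matrix.specialUnitaryGroup (Fin 2) ℂ)) ((γ * (F.P K).eps)⁻¹ / 2)).IsSolution (Literature.MathematicalPhysics.QuantumLattice.fundamentalRep (Fin 2)) hW.natFiltration P W U → ∀ (T : ℝ), T₀ ≤ T → |∫ V, h V ∂(Literature.MathematicalPhysics.QuantumFieldTheory.Balaban1983to89.T4GenFunBounds.gibbsMeasure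 (G := Matrix.specialUnitaryGroup (Fin 2) ℂ) (F.P K) ((F.scheme (Literature.MathematicalPhysics.QuantumFieldTheory.Balaban1983to89.ExpMeanLog.expMeanLogSU : Literature.MathematicalPhysics.QuantumFieldTheory.Balaban1983to89.LoopAverage (Matrix.specialUnitaryGroup (Fin 2) ℂ)) γ).β K)) - T⁻¹ * intervalIntegral (fun s : ℝ => MeasureTheory.integral P (fun ω => h (fun b : Literature.MathematicalPhysics.QuantumFieldTheory.Balaban1983to89.PBond (F.P K) 0 => U (s / (F.P K).eps).toNNReal ω (b.src, b.dir)))) 0 T MeasureTheory.volume| ≤ δ) := by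
  obtain ⟨γ₁, hγ₁, hmain⟩ := h
  refine ⟨γ₁, hγ₁, fun F γ hγ hγle δ hδ => ?_⟩
  obtain ⟨T₀, hT₀, K₀, hK⟩ := hmain F γ hγ hγle δ hδ
  refine ⟨T₀, hT₀, K₀, fun K hKK h' hSM hbd => hK K hKK h' (hSM.mono ?_) hbd⟩
  -- `σ(|θ|) ≤ σ(θ)`
  have habs : Measurable fun v : Fin 3 → ℝ => fun μ => |v μ| :=
    measurable_pi_lambda _ fun μ => (measurable_pi_apply μ).abs
  have hcomp : (fun (V : Literature.MathematicalPhysics.QuantumFieldTheory.Balaban1983to89.GaugeField (F.P K) 0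
        (Matrix.specialUnitaryGroup (Fin 2) ℂ)) (μ : Fin 3) =>
        |(Fintype.card F.USite : ℝ)⁻¹ * ∑ x : F.USite,
          F.avgObs (Literature.MathematicalPhysics.QuantumFieldTheory.Balaban1983to89.ExpMeanLog.expMeanLogSU :
            Literature.MathematicalPhysics.QuantumFieldTheory.Balaban1983to89.LoopAverage (Matrix.specialUnitaryGroup (Fin 2) ℂ))
            K (Literature.MathematicalPhysics.QuantumFieldTheory.Balaban1983to89.T3ContinuumYM3Torus.ULoop3.polyakov μ x) V|) =
      (fun v : Fin 3 → ℝ => fun μ => |v μ|) ∘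
        (fun (V : Literature.MathematicalPhysics.QuantumFieldTheory.Balaban1983to89.GaugeField (F.P K) 0
          (Matrix.specialUnitaryGroup (Fin 2) ℂ)) (μ : Fin 3) =>
          (Fintype.card F.USite : ℝ)⁻¹ * ∑ x : F.USite,
            F.avgObs (Literature.MathematicalPhysics.QuantumFieldTheory.Balaban1983to89.ExpMeanLog.expMeanLogSU :
              Literature.MathematicalPhysics.QuantumFieldTheory.Balaban1983to89.LoopAverage (Matrix.specialUnitaryGroup (Fin 2) ℂ))
              K (Literature.MathematicalPhysics.QuantumFieldTheory.Balaban1983to89.T3ContinuumYM3Torus.ULoop3.polyakov μ x) V) :=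
    rfl
  rw [hcomp, ← MeasurableSpace.comap_comp]
  exact MeasurableSpace.comap_mono habs.comap_le

end Summit.QuantumFields.YangMills.Theorems.ColdStartUniversality

end
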